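import Mathlib
import Literature.MathematicalPhysics.QuantumFieldTheory.OSData
import Literature.MathematicalPhysics.QuantumFieldTheory.OSTimeAxisNullVector
import Literature.MathematicalPhysics.QuantumFieldTheory.OSTransferSelfImprovement
import Summits.QuantumFields.YangMills.Theorems.PencilRigidityCurvatureKernelBoundChartDerivativeBoundsTensor
import HarnessLib

/-!
# `ContinuumLegGivenGap` — line `duality-selection-nlo-skewness`, stub `stub_bumpPairPositivity` (dictionary)

Helper file for crux `stmt-QuantumFields-15828` (`ComplexCouplingChannel.ContinuumLegGivenGap`, shared by
seven routes), Källén–Lehmann programme (blueprint item (P1)): **reflection positivity of bump pairs and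
the Laplace dichotomy** for OS data `T : OSData ι d` — the registered stub's statement, verbatim, is
`BumpPair.positivity_dichotomy` (the stub file is a one-line wrapper). For a real, non-negative, RADIAL bump `φ` supported
in `closedBall 0 r`, its translates `φ_a = φ(· − a)` (`SchwartzMap.compSubConstCLM ℂ a φ`) and
`W(a,b) = 𝔖₂^{ss}(φ_a ⊗ φ_b) − 𝔖₁^{s}(φ_a) 𝔖₁^{s}(φ_b)`, for `dist a b > 2r`:
* (ii) **covariance** — `W(a,b)` depends only on `dist a b`: E1 translations (`φ_a ⊗ φ_b` is
  off-diagonal, one-point tensors always are), proper rotations (a hypothesis for `d ≥ 2`; for `d = 1`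
  every vector is `± t e₀`) and E3 symmetry reduce every pair to the AXIS pair `(−τe₀, τe₀)`,
  `τ = dist a b / 2` (`BumpPair.schwinger_two_eq_axis`);
* (i) **positivity** at the axis pair in the E1-free OS reconstruction `OSReconstructionNoE1`: radiality
  and realness give `Θ(φ_{τe₀}-lift)* = φ_{−τe₀}-lift`, so `W(−τe₀, τe₀) = ‖Ψ − ⟨Ω,Ψ⟩Ω‖²` with `Ψ` the
  field vector of the lift of `φ_{τe₀}` (`BumpPair.truncated_axis_eq_inner`);
* (iii) **dichotomy** — `e^{−uH}` maps `ψ_τ = Ψ_τ − ⟨Ω,Ψ_τ⟩Ω` to `ψ_{τ+u}`, so one zero of `τ ↦ ‖ψ_τ‖²`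
  propagates up by the semigroup and down by `OSReconstructionNoE1.eq_zero_of_inner_transfer_eq_zero`.

References: Osterwalder–Schrader, CMP 31 (1973) §4.1; Glimm–Jaffe (1987) §6.1 Thm. 6.1.3, §6.2. [folklore]
-/

noncomputable section

namespace Summit.QuantumFields.YangMills.Cruxes.ContinuumLegGivenGap.DualitySelectionNloSkewness

open scoped SchwartzMap InnerProductSpace ComplexOrder
open Filter Topology MeasureTheory Summit.QuantumFields.YangMills.Theorems.CurvatureKernel
open Literature.MathematicalPhysics.QuantumFieldTheory Literature.MathematicalPhysics.QuantumLattice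
  Literature.MathematicalPhysics.AQFT
open Literature.MathematicalPhysics.QuantumLattice.SchwingerFamily (timeVec timeVec_add timeReflection_timeVec)
open SchwartzMap (tensorFin compSubConstCLM compSubConstCLM_apply compSubConstCLM_comp compSubConstCLM_zero)

namespace BumpPair

section Generic

variable {E : Type*} [NormedAddCommGroup E] [NormedSpace ℝ E]

/-- One-point test functions are off-diagonal: the coincidence locus of `Fin 1` is empty. [folklore] -/
theorem isOffDiagonal_of_fin_one (F : 𝓢((Fin 1 → E), ℂ)) : IsOffDiagonal F := by
  rintro x ⟨i, j, hij, -⟩ k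
  exact absurd (Subsingleton.elim i j) hij

/-- Translating the lift of a translate: `(φ_a-lift)_{(c,1)} = φ_{a+c}-lift`. [folklore] -/
theorem translateMulti_tensorFin_one_compSubConstCLM (c a : E) (φ : 𝓢(E, ℂ)) :
    translateMulti c (tensorFin 1 ![compSubConstCLM ℂ a φ]) = tensorFin 1 ![compSubConstCLM ℂ (a + c) φ] := by
  ext x
  rw [translateMulti_apply, tensorFin_one_eval, tensorFin_one_eval]
  simp only [compSubConstCLM_apply]
  congr 1
  abel

/-- Translating a tensor of translates: `(φ_a ⊗ φ_b)_{(c,1)} = φ_{a+c} ⊗ φ_{b+c}`. [folklore] -/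
theorem translateMulti_tensorFin_two_compSubConstCLM (c a b : E) (φ : 𝓢(E, ℂ)) :
    translateMulti c (tensorFin 2 ![compSubConstCLM ℂ a φ, compSubConstCLM ℂ b φ]) =
      tensorFin 2 ![compSubConstCLM ℂ (a + c) φ, compSubConstCLM ℂ (b + c) φ] := by
  rw [translateMulti_tensorFin_two, compSubConstCLM_comp, compSubConstCLM_comp]

/-- Swapping the two arguments swaps the factors: `(f ⊗ g)^{(01)} = g ⊗ f`. [folklore] -/
theorem permTest_swap_tensorFin_two (f g : 𝓢(E, ℂ)) :
    permTest (Equiv.swap 0 1) (tensorFin 2 ![f, g]) = tensorFin 2 ![g, f] := by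
  ext x
  rw [permTest_apply, tensorFin_two_eval, tensorFin_two_eval]
  simp only [Function.comp_apply, Equiv.swap_apply_left, Equiv.swap_apply_right]
  ring

/-- A linear isometry fixing `φ` moves the centres of a tensor of translates:
`(φ_a ⊗ φ_b)_{(0,L)} = φ_{La} ⊗ φ_{Lb}`. [folklore] -/
theorem linActMulti_tensorFin_two_compSubConstCLM (L : E ≃ₗᵢ[ℝ] E) (φ : 𝓢(E, ℂ))
    (hφ : ∀ x, φ (L.symm x) = φ x) (a b : E) :
    linActMulti L (tensorFin 2 ![compSubConstCLM ℂ a φ, compSubConstCLM ℂ b φ]) =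
      tensorFin 2 ![compSubConstCLM ℂ (L a) φ, compSubConstCLM ℂ (L b) φ] := by
  ext x
  rw [linActMulti_apply, tensorFin_two_eval, tensorFin_two_eval]
  simp only [compSubConstCLM_apply]
  rw [← hφ (x 0 - L a), ← hφ (x 1 - L b), L.symm.map_sub, L.symm.map_sub, L.symm_apply_apply,
    L.symm_apply_apply]

/-- The translate of a bump supported in `closedBall 0 r` is supported in `closedBall a r`. [folklore] -/
theorem tsupport_compSubConstCLM_subset_closedBall {φ : 𝓢(E, ℂ)} {r : ℝ}
    (h : tsupport (φ : E → ℂ) ⊆ Metric.closedBall 0 r) (a : E) :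
    tsupport ((compSubConstCLM ℂ a φ : 𝓢(E, ℂ)) : E → ℂ) ⊆ Metric.closedBall a r := by
  intro x hx
  have h1 := h (sub_mem_tsupport_of_mem_tsupport_compSubConstCLM a φ hx)
  rw [Metric.mem_closedBall, dist_zero_right] at h1
  rwa [Metric.mem_closedBall, dist_eq_norm]

/-- **Separated bump pairs are off-diagonal**: for `dist a b > 2r`, `φ_a ⊗ φ_b ∈ ⁰𝒮` (disjoint balls). [folklore] -/
theorem isOffDiagonal_tensorFin_two_compSubConstCLM {φ : 𝓢(E, ℂ)} {r : ℝ}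
    (h : tsupport (φ : E → ℂ) ⊆ Metric.closedBall 0 r) {a b : E} (hab : 2 * r < dist a b) :
    IsOffDiagonal (tensorFin 2 ![compSubConstCLM ℂ a φ, compSubConstCLM ℂ b φ]) := by
  refine isOffDiagonal_tensorFin_two_of_disjoint (Set.disjoint_left.2 fun x hxa hxb => ?_)
  have ha := tsupport_compSubConstCLM_subset_closedBall h a hxa
  have hb := tsupport_compSubConstCLM_subset_closedBall h b hxb
  rw [Metric.mem_closedBall] at ha hb
  linarith [dist_triangle_left a b x]

/-- Appending constant label strings (one of them reversed) gives the constant label string. [folklore] -/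
theorem append_const_comp_rev {ι : Type*} (n m : ℕ) (s : ι) :
    Fin.append ((fun _ : Fin n => s) ∘ Fin.rev) (fun _ : Fin m => s) = fun _ => s := by
  funext i
  refine Fin.addCases (fun j => ?_) (fun j => ?_) i
  · rw [Fin.append_left]; rfl
  · rw [Fin.append_right]

end Generic

section TimeAxis

variable {d : ℕ} [NeZero d]

/-- `‖t e₀‖ = |t|`. [folklore] -/
theorem norm_timeVec (t : ℝ) : ‖(timeVec t : EuclideanSpace ℝ (Fin d))‖ = |t| := by
  rw [show (timeVec t : EuclideanSpace ℝ (Fin d)) = EuclideanSpace.single 0 t from rfl,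
    PiLp.norm_single, Real.norm_eq_abs]

/-- `(-t) e₀ = -(t e₀)`. [folklore] -/
theorem timeVec_neg (t : ℝ) : (timeVec (-t) : EuclideanSpace ℝ (Fin d)) = -timeVec t := by
  change (PiLp.single 2 0 (-t) : EuclideanSpace ℝ (Fin d)) = -PiLp.single 2 0 t
  exact PiLp.single_neg 2 0

/-- In dimension `d = 1` every vector is a multiple of `e₀`. [folklore] -/
theorem eq_timeVec_of_lt_two (hd : d < 2) (u : EuclideanSpace ℝ (Fin d)) : u = timeVec (u 0) := by
  have h0 : ∀ i : Fin d, i = 0 := fun i => Fin.ext (by have := i.isLt; rw [Fin.val_zero d]; omega)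
  ext i; rw [h0 i]; simp [timeVec]

end TimeAxis

section OS

variable {ι : Type} {d : ℕ} [NeZero d] (T : OSData ι d) (s : ι) (φ : 𝓢(EuclideanSpace ℝ (Fin d), ℂ)) {r : ℝ}
  (hsupp : tsupport (φ : EuclideanSpace ℝ (Fin d) → ℂ) ⊆ Metric.closedBall 0 r)
  (hrad : ∀ (L : EuclideanSpace ℝ (Fin d) ≃ₗᵢ[ℝ] EuclideanSpace ℝ (Fin d)) (x : EuclideanSpace ℝ (Fin d)),
    φ (L x) = φ x)
  (hreal : ∀ x, (φ x).im = 0)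

/-- **The one-point function of a translate does not depend on the centre** (E1 translations). [folklore] -/
theorem schwinger_one_compSubConstCLM (a : EuclideanSpace ℝ (Fin d)) :
    T.schwinger 1 (fun _ => s) (tensorFin 1 ![compSubConstCLM ℂ a φ]) =
      T.schwinger 1 (fun _ => s) (tensorFin 1 ![φ]) := by
  have h := translateMulti_tensorFin_one_compSubConstCLM a (0 : EuclideanSpace ℝ (Fin d)) φ
  rw [zero_add, compSubConstCLM_zero, ContinuousLinearMap.id_apply] at h
  rw [← h]; exact T.invariant.1 1 _ a _ (isOffDiagonal_of_fin_one _)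

section Translates
include hsupp

/-- **Translation covariance of the bump two-point function** (E1 on the off-diagonal `φ_a ⊗ φ_b`). [folklore] -/
theorem schwinger_two_translate {a b : EuclideanSpace ℝ (Fin d)} (hab : 2 * r < dist a b)
    (c : EuclideanSpace ℝ (Fin d)) :
    T.schwinger 2 (fun _ => s) (tensorFin 2 ![compSubConstCLM ℂ (a + c) φ, compSubConstCLM ℂ (b + c) φ]) =
      T.schwinger 2 (fun _ => s) (tensorFin 2 ![compSubConstCLM ℂ a φ, compSubConstCLM ℂ b φ]) := by
  rw [← translateMulti_tensorFin_two_compSubConstCLM c a b φ]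
  exact T.invariant.1 2 _ c _ (isOffDiagonal_tensorFin_two_compSubConstCLM hsupp hab)

/-- **Swap symmetry of the bump two-point function** (E3 on the off-diagonal tensor). [folklore] -/
theorem schwinger_two_swap {a b : EuclideanSpace ℝ (Fin d)} (hab : 2 * r < dist a b) :
    T.schwinger 2 (fun _ => s) (tensorFin 2 ![compSubConstCLM ℂ b φ, compSubConstCLM ℂ a φ]) =
      T.schwinger 2 (fun _ => s) (tensorFin 2 ![compSubConstCLM ℂ a φ, compSubConstCLM ℂ b φ]) := by
  rw [← permTest_swap_tensorFin_two (compSubConstCLM ℂ a φ) (compSubConstCLM ℂ b φ)]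
  exact T.symmetric 2 (fun _ => s) (Equiv.swap 0 1) _
    (isOffDiagonal_tensorFin_two_compSubConstCLM hsupp hab)

/-- For `τ > r` the translate `φ_{τe₀}` is supported in the open half-space `{y⁰ > 0}`. [folklore] -/
theorem tsupport_compSubConstCLM_timeVec_subset {τ : ℝ} (hτ : r < τ) :
    tsupport ((compSubConstCLM ℂ (timeVec τ) φ : 𝓢(EuclideanSpace ℝ (Fin d), ℂ)) :
      EuclideanSpace ℝ (Fin d) → ℂ) ⊆ {y | 0 < y 0} := by
  intro y hy
  have h1 := tsupport_compSubConstCLM_subset_closedBall hsupp (timeVec τ) hy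
  rw [Metric.mem_closedBall, dist_eq_norm] at h1
  have h2 := (PiLp.norm_apply_le (y - timeVec τ) 0).trans h1
  rw [PiLp.sub_apply, OSReconstructionNoE1.timeVec_apply_zero, Real.norm_eq_abs, abs_le] at h2
  show 0 < y 0
  linarith [h2.1]

/-- For `τ > r` the lift of `φ_{τe₀}` is a time-ordered one-point test function. [folklore] -/
theorem isTimeOrdered_bump {τ : ℝ} (hτ : r < τ) : IsTimeOrdered (tensorFin 1 ![compSubConstCLM ℂ (timeVec τ) φ]) :=
  isTimeOrdered_tensorFin_one (tsupport_compSubConstCLM_timeVec_subset φ hsupp hτ)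

end Translates

section Rotations
include hsupp hrad

/-- **Rotation covariance of the bump two-point function** for a RADIAL bump (E1 proper rotations). [folklore] -/
theorem schwinger_two_rotate {a b : EuclideanSpace ℝ (Fin d)} (hab : 2 * r < dist a b)
    (R : EuclideanSpace ℝ (Fin d) ≃ₗᵢ[ℝ] EuclideanSpace ℝ (Fin d))
    (hR : LinearMap.det (R.toLinearEquiv : EuclideanSpace ℝ (Fin d) →ₗ[ℝ] EuclideanSpace ℝ (Fin d)) = 1) :
    T.schwinger 2 (fun _ => s) (tensorFin 2 ![compSubConstCLM ℂ (R a) φ, compSubConstCLM ℂ (R b) φ]) =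
      T.schwinger 2 (fun _ => s) (tensorFin 2 ![compSubConstCLM ℂ a φ, compSubConstCLM ℂ b φ]) := by
  rw [← linActMulti_tensorFin_two_compSubConstCLM R φ (fun x => hrad R.symm x) a b]
  exact T.invariant.2 2 _ R hR _ (isOffDiagonal_tensorFin_two_compSubConstCLM hsupp hab)

/-- **Reduction to the axis pair**: for `dist a b > 2r` the bump two-point function equals its
value at the axis pair `(−τe₀, τe₀)`, `τ = dist a b / 2` (translate the midpoint to the origin,
then rotate `b − a` to the time axis for `d ≥ 2`, resp. swap the factors if needed for `d = 1`). [folklore] -/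
theorem schwinger_two_eq_axis
    (hrot : 2 ≤ d → ∀ u v : EuclideanSpace ℝ (Fin d), ‖u‖ = ‖v‖ →
      ∃ R : EuclideanSpace ℝ (Fin d) ≃ₗᵢ[ℝ] EuclideanSpace ℝ (Fin d),
        LinearMap.det (R.toLinearEquiv : EuclideanSpace ℝ (Fin d) →ₗ[ℝ] EuclideanSpace ℝ (Fin d)) = 1 ∧ R u = v)
    {a b : EuclideanSpace ℝ (Fin d)} (hab : 2 * r < dist a b) :
    T.schwinger 2 (fun _ => s) (tensorFin 2 ![compSubConstCLM ℂ a φ, compSubConstCLM ℂ b φ]) =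
      T.schwinger 2 (fun _ => s) (tensorFin 2
        ![compSubConstCLM ℂ (-timeVec (dist a b / 2)) φ, compSubConstCLM ℂ (timeVec (dist a b / 2)) φ]) := by
  -- translate the midpoint to the origin
  set u : EuclideanSpace ℝ (Fin d) := (1 / 2 : ℝ) • (b - a) with hu
  have hnorm : ‖u‖ = dist a b / 2 := by
    rw [hu, norm_smul, dist_eq_norm, ← norm_neg (a - b), neg_sub, Real.norm_of_nonneg (by norm_num)]
    ring
  have hdist : dist (-u) u = dist a b := by
    rw [dist_eq_norm, show -u - u = -((2 : ℝ) • u) by module, norm_neg, norm_smul,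
      Real.norm_of_nonneg zero_le_two, hnorm]
    ring
  have hab' : 2 * r < dist (-u) u := hdist ▸ hab
  have h1 : T.schwinger 2 (fun _ => s) (tensorFin 2 ![compSubConstCLM ℂ a φ, compSubConstCLM ℂ b φ]) =
      T.schwinger 2 (fun _ => s) (tensorFin 2 ![compSubConstCLM ℂ (-u) φ, compSubConstCLM ℂ u φ]) := by
    have e1 : a + -(1 / 2 : ℝ) • (a + b) = -u := by rw [hu]; module
    have e2 : b + -(1 / 2 : ℝ) • (a + b) = u := by rw [hu]; module
    rw [← schwinger_two_translate T s φ hsupp hab (-(1 / 2 : ℝ) • (a + b)), e1, e2]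
  rw [h1, ← hnorm]
  rcases le_or_gt 2 d with hd | hd
  · -- `d ≥ 2`: rotate `u` to the time axis
    obtain ⟨R, hR, hRu⟩ := hrot hd u (timeVec ‖u‖) (by rw [norm_timeVec, abs_of_nonneg (norm_nonneg _)])
    rw [← schwinger_two_rotate T s φ hsupp hrad hab' R hR, map_neg, hRu]
  · -- `d = 1`: `u = ± ‖u‖ e₀`
    have hu0 : u = timeVec (u 0) := eq_timeVec_of_lt_two hd u
    have habs : |u 0| = ‖u‖ := by conv_rhs => rw [hu0, norm_timeVec]
    rcases le_total 0 (u 0) with h0 | h0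
    · have hu1 : u = timeVec ‖u‖ := by rw [← habs, abs_of_nonneg h0]; exact hu0
      rw [← hu1]
    · have hu1 : -u = timeVec ‖u‖ := by
        rw [← habs, abs_of_nonpos h0, timeVec_neg, neg_inj]; exact hu0
      have hab'' : 2 * r < dist (-timeVec ‖u‖ : EuclideanSpace ℝ (Fin d)) (timeVec ‖u‖) := by
        rw [← hu1, neg_neg, dist_comm]; exact hab'
      rw [← schwinger_two_swap T s φ hsupp hab'', ← hu1, neg_neg]

end Rotations

/-- **`e^{−uH}` shifts the bump field vector along the time axis**: `e^{−uH} Ψ_{φ_{τe₀}} = Ψ_{φ_{(τ+u)e₀}}`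
for `u ≥ 0`. [folklore] -/
theorem transfer_fieldVec_bump (hOS : OSReconstructionNoE1 T.schwinger) {τ : ℝ} (hτ : r < τ) {u : ℝ}
    (hu : 0 ≤ u) : hOS.transfer u (hOS.fieldVec 1 (fun _ => s) _ (isTimeOrdered_bump φ hsupp hτ)) =
      hOS.fieldVec 1 (fun _ => s) _
        (isTimeOrdered_bump φ hsupp (hτ.trans_le (le_add_of_nonneg_right hu) : r < τ + u)) := by
  rw [hOS.transfer_fieldVec hu]
  congr 1
  rw [translateMulti_tensorFin_one_compSubConstCLM, timeVec_add]

section Reflection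
include hrad hreal

/-- Realness and radiality: `conj φ(θy − τe₀) = φ(y + τe₀)` (`θ(y + τe₀) = θy − τe₀`). [folklore] -/
theorem conj_apply_timeReflection_sub_timeVec (τ : ℝ) (y : EuclideanSpace ℝ (Fin d)) :
    (starRingEnd ℂ) (φ (timeReflection d y - timeVec τ)) = φ (y - -timeVec τ) := by
  rw [Complex.conj_eq_iff_im.2 (hreal _), sub_neg_eq_add, ← hrad (timeReflection d) (y + timeVec τ),
    map_add, timeReflection_timeVec, sub_eq_add_neg]

/-- **`Θ(φ_{τe₀}-lift)* = φ_{−τe₀}-lift`** for a real radial bump. [folklore] -/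
theorem osAdjoint_bump (τ : ℝ) : osAdjoint (tensorFin 1 ![compSubConstCLM ℂ (timeVec τ) φ]) =
    tensorFin 1 ![compSubConstCLM ℂ (-timeVec τ) φ] := by
  ext x
  rw [osAdjoint_tensorFin_one_apply, tensorFin_one_eval, compSubConstCLM_apply, compSubConstCLM_apply,
    conj_apply_timeReflection_sub_timeVec φ hrad hreal]

/-- **OS tensor witness of the axis pair**: `φ_{−τe₀} ⊗ φ_{τe₀}` witnesses
`Θ(φ_{τe₀}-lift)* ⊗ φ_{τe₀}-lift`. [folklore] -/
theorem isAppendTensorOf_bumpPair (τ : ℝ) :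
    IsAppendTensorOf (tensorFin 2 ![compSubConstCLM ℂ (-timeVec τ) φ, compSubConstCLM ℂ (timeVec τ) φ])
      (osAdjoint (tensorFin 1 ![compSubConstCLM ℂ (timeVec τ) φ])) (tensorFin 1 ![compSubConstCLM ℂ (timeVec τ) φ]) := by
  intro x
  rw [osAdjoint_tensorFin_one_apply, tensorFin_one_eval, tensorFin_two_eval, compSubConstCLM_apply,
    compSubConstCLM_apply, compSubConstCLM_apply, Function.comp_apply, Function.comp_apply,
    conj_apply_timeReflection_sub_timeVec φ hrad hreal]
  rfl

/-- **The truncated axis value is a squared norm**: with `Ψ` the OS field vector of the lift of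
`φ_{τe₀}` (`τ > r`) and `Ω` the vacuum,
`𝔖₂(φ_{−τe₀} ⊗ φ_{τe₀}) − 𝔖₁(φ_{−τe₀}) 𝔖₁(φ_{τe₀}) = ⟨Ψ − ⟨Ω,Ψ⟩Ω, Ψ − ⟨Ω,Ψ⟩Ω⟩`
(`⟨Ψ,Ψ⟩ = 𝔖₂(ΘF* ⊗ F)`, `⟨Ψ,Ω⟩ = 𝔖₁(ΘF*)`, `⟨Ω,Ψ⟩ = 𝔖₁(F)` and `ΘF* = φ_{−τe₀}`-lift). [folklore] -/
theorem truncated_axis_eq_inner (hOS : OSReconstructionNoE1 T.schwinger) {τ : ℝ} (hτ : r < τ) :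
    T.schwinger 2 (fun _ => s) (tensorFin 2 ![compSubConstCLM ℂ (-timeVec τ) φ, compSubConstCLM ℂ (timeVec τ) φ]) -
      T.schwinger 1 (fun _ => s) (tensorFin 1 ![compSubConstCLM ℂ (-timeVec τ) φ]) *
        T.schwinger 1 (fun _ => s) (tensorFin 1 ![compSubConstCLM ℂ (timeVec τ) φ]) =
      ⟪hOS.fieldVec 1 (fun _ => s) _ (isTimeOrdered_bump φ hsupp hτ) -
          ⟪hOS.vacuum, hOS.fieldVec 1 (fun _ => s) _ (isTimeOrdered_bump φ hsupp hτ)⟫_ℂ • hOS.vacuum,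
        hOS.fieldVec 1 (fun _ => s) _ (isTimeOrdered_bump φ hsupp hτ) -
          ⟪hOS.vacuum, hOS.fieldVec 1 (fun _ => s) _ (isTimeOrdered_bump φ hsupp hτ)⟫_ℂ • hOS.vacuum⟫_ℂ := by
  have key := hOS.inner_proj_transfer_proj T.normalized 0
    (hOS.fieldVec 1 (fun _ => s) _ (isTimeOrdered_bump φ hsupp hτ))
    (hOS.fieldVec 1 (fun _ => s) _ (isTimeOrdered_bump φ hsupp hτ))
  simp only [hOS.transfer_zero, ContinuousLinearMap.coe_id', id_eq] at key
  rw [key, hOS.inner_fieldVec_fieldVec _ _ _ _ (isAppendTensorOf_bumpPair φ hrad hreal τ),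
    hOS.inner_fieldVec_vacuum, hOS.inner_vacuum_fieldVec, osAdjoint_bump φ hrad hreal,
    append_const_comp_rev]
  rfl

end Reflection

end OS

/-- **Reflection positivity of bump pairs and the Laplace dichotomy** (statement of the registered stub
`stub_bumpPairPositivity` of line `duality-selection-nlo-skewness`, verbatim). For OS data `T`,
a species `s`, a real non-negative RADIAL bump `φ` supported in `closedBall 0 r` and the truncated two-point value
`W(a,b) = 𝔖₂(φ_a ⊗ φ_b) − 𝔖₁(φ_a)𝔖₁(φ_b)` of its translates (`φ_a = φ(· − a)`): for `dist a b > 2r`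
(i) `W(a,b) ≥ 0` (real); (ii) `W(a,b)` depends only on `dist a b` (E1 translations + proper rotations — supplied as a
hypothesis for `d ≥ 2` — and E3 symmetry); (iii) if `Re W` vanishes at ONE separated pair it vanishes at all of them.
Mechanism: at the axis pair `a = −(t/2)e₀, b = (t/2)e₀` radiality gives `φ_a = Θ(φ_b)*`, so by E2 (list `(1, φ_b)`)
`W = ‖P_Ω^⊥ Ψ_{φ_b}‖²` in the E1-free OS reconstruction, and `t ↦ W` is `‖e^{-uH/2}ψ‖²`, which vanishes at one `u`
iff `ψ = 0` (`OSReconstructionNoE1.eq_zero_of_inner_transfer_eq_zero`). [folklore] -/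
theorem positivity_dichotomy :
    (∀ (ι : Type) (d : ℕ) [NeZero d] (T : OSData ι d) (s : ι)
      (φ : 𝓢(EuclideanSpace ℝ (Fin d), ℂ)) (r : ℝ), 0 < r →
      (∀ x, (φ x).im = 0 ∧ 0 ≤ (φ x).re) →
      (∀ (L : EuclideanSpace ℝ (Fin d) ≃ₗᵢ[ℝ] EuclideanSpace ℝ (Fin d)) (x : EuclideanSpace ℝ (Fin d)), φ (L x) = φ x) →
      tsupport (φ : EuclideanSpace ℝ (Fin d) → ℂ) ⊆ Metric.closedBall 0 r →
      (2 ≤ d → ∀ u v : EuclideanSpace ℝ (Fin d), ‖u‖ = ‖v‖ →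
        ∃ R : EuclideanSpace ℝ (Fin d) ≃ₗᵢ[ℝ] EuclideanSpace ℝ (Fin d),
          LinearMap.det (R.toLinearEquiv : EuclideanSpace ℝ (Fin d) →ₗ[ℝ] EuclideanSpace ℝ (Fin d)) = 1 ∧ R u = v) →
      let W : EuclideanSpace ℝ (Fin d) → EuclideanSpace ℝ (Fin d) → ℂ := fun a b =>
        T.schwinger 2 (fun _ => s) (SchwartzMap.tensorFin 2
            ![SchwartzMap.compSubConstCLM ℂ a φ, SchwartzMap.compSubConstCLM ℂ b φ]) -
          T.schwinger 1 (fun _ => s) (SchwartzMap.tensorFin 1 ![SchwartzMap.compSubConstCLM ℂ a φ]) *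
            T.schwinger 1 (fun _ => s) (SchwartzMap.tensorFin 1 ![SchwartzMap.compSubConstCLM ℂ b φ])
      (∀ a b : EuclideanSpace ℝ (Fin d), 2 * r < dist a b → 0 ≤ (W a b).re ∧ (W a b).im = 0) ∧
      (∀ a b a' b' : EuclideanSpace ℝ (Fin d), 2 * r < dist a b → dist a b = dist a' b' → W a b = W a' b') ∧
      ((∃ a b : EuclideanSpace ℝ (Fin d), 2 * r < dist a b ∧ (W a b).re = 0) →
        ∀ a b : EuclideanSpace ℝ (Fin d), 2 * r < dist a b → (W a b).re = 0)) := by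
  intro ι d _ T s φ r hr hφ hrad hsupp hrot W
  have hreal : ∀ x, (φ x).im = 0 := fun x => (hφ x).1
  have hOS : OSReconstructionNoE1 T.schwinger := OSReconstructionNoE1.of_osAxioms T.osAxioms
  -- (ii): every separated pair is an axis pair
  have axisW : ∀ a b : EuclideanSpace ℝ (Fin d), 2 * r < dist a b →
      W a b = W (-timeVec (dist a b / 2)) (timeVec (dist a b / 2)) := by
    intro a b hab
    show _ - _ = _ - _
    rw [schwinger_two_eq_axis T s φ hsupp hrad hrot hab, schwinger_one_compSubConstCLM T s φ a,
      schwinger_one_compSubConstCLM T s φ b, schwinger_one_compSubConstCLM T s φ (-timeVec _),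
      schwinger_one_compSubConstCLM T s φ (timeVec _)]
  -- the vacuum-projected bump field vectors `ψ τ`, `τ > r`
  obtain ⟨Ψ, hΨ⟩ : ∃ Ψ : ℝ → hOS.Hilbert, ∀ (τ : ℝ) (hτ : r < τ),
      Ψ τ = hOS.fieldVec 1 (fun _ => s) _ (isTimeOrdered_bump φ hsupp hτ) :=
    ⟨fun τ => if hτ : r < τ then hOS.fieldVec 1 (fun _ => s) _ (isTimeOrdered_bump φ hsupp hτ) else 0,
      fun τ hτ => dif_pos hτ⟩
  obtain ⟨ψ, hψ⟩ : ∃ ψ : ℝ → hOS.Hilbert, ∀ τ, ψ τ = Ψ τ - ⟪hOS.vacuum, Ψ τ⟫_ℂ • hOS.vacuum :=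
    ⟨fun τ => Ψ τ - ⟪hOS.vacuum, Ψ τ⟫_ℂ • hOS.vacuum, fun τ => rfl⟩
  -- (i) at the axis: `W(−τe₀, τe₀) = ‖ψ τ‖²`
  have inner_ψ : ∀ τ : ℝ, r < τ → W (-timeVec τ) (timeVec τ) = ((‖ψ τ‖ ^ 2 : ℝ) : ℂ) := by
    intro τ hτ
    have h1 := hOS.inner_transfer_self_eq le_rfl (ψ τ)
    simp only [hOS.transfer_zero, zero_div, ContinuousLinearMap.coe_id', id_eq] at h1
    rw [← h1, hψ τ, hΨ τ hτ]
    exact truncated_axis_eq_inner T s φ hsupp hrad hreal hOS hτ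
  -- (iii) engine: `e^{−uH} ψ_τ = ψ_{τ+u}`
  have transfer_ψ : ∀ τ : ℝ, r < τ → ∀ u : ℝ, 0 ≤ u → hOS.transfer u (ψ τ) = ψ (τ + u) := by
    intro τ hτ u hu
    have hshift : hOS.transfer u (Ψ τ) = Ψ (τ + u) := by
      rw [hΨ τ hτ, hΨ (τ + u) (hτ.trans_le (le_add_of_nonneg_right hu))]
      exact transfer_fieldVec_bump T s φ hsupp hOS hτ hu
    rw [hψ τ, hψ (τ + u), map_sub, map_smul, hOS.transfer_vacuum, ← hshift, hOS.inner_vacuum_transfer]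
  refine ⟨fun a b hab => ?_, fun a b a' b' hab habeq => ?_, ?_⟩
  · rw [axisW a b hab, inner_ψ _ (by linarith), Complex.ofReal_re, Complex.ofReal_im]
    exact ⟨sq_nonneg _, rfl⟩
  · rw [axisW a b hab, axisW a' b' (habeq ▸ hab), habeq]
  · rintro ⟨a₀, b₀, hab₀, h0⟩ a b hab
    have hτ₀ : r < dist a₀ b₀ / 2 := by linarith
    have hτ : r < dist a b / 2 := by linarith
    -- one zero of `τ ↦ ψ τ` …
    have hψ₀ : ψ (dist a₀ b₀ / 2) = 0 := by
      rw [axisW a₀ b₀ hab₀, inner_ψ _ hτ₀, Complex.ofReal_re] at h0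
      exact norm_eq_zero.1 (pow_eq_zero_iff two_ne_zero |>.1 h0)
    -- … propagates to every `τ > r`
    have hψτ : ψ (dist a b / 2) = 0 := by
      rcases le_or_gt (dist a₀ b₀ / 2) (dist a b / 2) with hle | hlt
      · have h1 := transfer_ψ _ hτ₀ (dist a b / 2 - dist a₀ b₀ / 2) (by linarith)
        rw [hψ₀, map_zero, add_sub_cancel] at h1
        exact h1.symm
      · refine hOS.eq_zero_of_inner_transfer_eq_zero (t := 2 * (dist a₀ b₀ / 2 - dist a b / 2))
          (by linarith) ?_
        rw [hOS.inner_transfer_self_eq (by linarith), mul_div_cancel_left₀ _ (two_ne_zero' ℝ),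
          transfer_ψ _ hτ _ (by linarith), add_sub_cancel, hψ₀, norm_zero]
        simp
    rw [axisW a b hab, inner_ψ _ hτ, hψτ, norm_zero, Complex.ofReal_re]
    ring

end BumpPair

end Summit.QuantumFields.YangMills.Cruxes.ContinuumLegGivenGap.DualitySelectionNloSkewness

end
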